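import Mathlib
import HarnessLib
import Summits.HubbardSuperconductivity.HubbardSuperconductivity.Theorems.WeakCouplingBCSKlCausticWindow

/-!
# r11 (hubbard-klscan-idea-1 g11, anomaly reader) — the junk value `χ₀(0) = 0` of the tree's Lindhard function
# and INPUT (C) `KlCausticWindow.CooperDiscModulusTP` of `Theorems/WeakCouplingBCSKlCausticWindow.lean` §6 (p696173)

FINDING.  `lindhardIntegrand ε μ 0 p = 0` for every `p` (the `if f(p) = f(p+q) then 0` branch is taken at `q = 0`), hence
`lindhardFunction ε μ 0 = 0` for EVERY band and level, although `χ₀(q) → ρ(μ) > 0` as `q → 0` (RKS (6)); the tree's `χ₀` has a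
removable-type discontinuity at `q = 0` (and, by periodicity of `ε`, on the whole reciprocal lattice).  This is harmless for
`pairingForm` / `channelInf` and for every INTEGRAL-typed enclosure (`KLBlock.RitzEnclosure`, `KLCert.EnclosuresB1g`, the HS-norm
fields `orth/ceiling/floor` of `KlRidgeSplit.KLSplitCellCertificate` / `KlCausticWindow.KLWindowSplitCertificate`: null sets do not
matter), but it BITES the one pointwise input typed AT `q = 0`:

  `CooperDiscModulusTP tp μ r ηC := ∀ q, ‖q‖ ≤ r → |chi0TP tp μ q - chi0TP tp μ 0| ≤ ηC`

is, as typed, the statement `∀ q, ‖q‖ ≤ r → |χ₀(q)| ≤ ηC` (theorem `cooperDiscModulusTP_iff_abs_le` below), i.e. it asks `χ₀`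
itself to be `≤ ηC` on the Cooper disc — incompatible with its docstring ("float at the cell: `η_C ≈ 10⁻⁴` for `r = 0.07`";
there `χ₀ ≈ ρ ≈ 0.24` on the punctured disc) and refuted by ANY certified positive lower bound `ηC < χ₀(q₀)` at one point of the
disc (`not_cooperDiscModulusTP_of_lt`).  Nothing landed consumes (C) (it is a free-standing producer target; `rg` over the tree:
definition + `cooperDiscModulusTP_mono` only), so no theorem is vacuous; but a producer handed (C) as typed would be refuted.

REPAIR (supersede, do not reword in place): the punctured-disc modulus about an explicit centre value `c₀` (a record rational,
the engine's enclosure of `χ₀(0⁺) = ρ(μ)`), `CooperDiscModulusPuncTP` below, with its monotonicity and the bridge showing that the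
old (C) is the special case `c₀ = 0` restricted to `q ≠ 0` — so every consumer written against (C) ports by one rewrite.
-/

noncomputable section

-- the tree's namespace `Summit.<Summit>.<Problem>.Theorems` repeats the summit name by design (D-0017)
set_option linter.dupNamespace false

namespace Summit.HubbardSuperconductivity.HubbardSuperconductivity.Theorems.KlCausticWindow

open MeasureTheory Literature.MathematicalPhysics.QuantumLattice

/-- At zero momentum transfer the tree's Lindhard integrand vanishes identically (the two occupations agree). -/
theorem lindhardIntegrand_zero_transfer (ε : Momentum → ℝ) (μ : ℝ) (p : Momentum) :
    lindhardIntegrand ε μ 0 p = 0 := by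
  simp [lindhardIntegrand]

/-- **Junk value**: the tree's static Lindhard function vanishes AT `q = 0` (its limit there is the density of states `ρ > 0`). -/
theorem lindhardFunction_zero_transfer (ε : Momentum → ℝ) (μ : ℝ) : lindhardFunction ε μ 0 = 0 := by
  simp [lindhardFunction, lindhardIntegrand_zero_transfer]

/-- More generally the tree's `χ₀` vanishes AT every period `G` of the band (`ε (p + G) = ε p` for all `p`; for `squareDispersion`
every `G ∈ 2πℤ²`): the junk set contains the whole reciprocal lattice, where the limit value is again `ρ(μ) > 0`.  (The `M`-pocket's
Cooper band `k + k′ ≈ 2M` meets it at `q = 0` AND at `(±2π, 0), (0, ±2π), (±2π, ±2π)` in unfolded Brillouin-zone coordinates.) -/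
theorem lindhardFunction_period_transfer {ε : Momentum → ℝ} {G : Momentum} (hG : ∀ p, ε (p + G) = ε p) (μ : ℝ) :
    lindhardFunction ε μ G = 0 := by
  have h : ∀ p, lindhardIntegrand ε μ G p = 0 := fun p => by
    have hocc : fermiOccupation ε μ (p + G) = fermiOccupation ε μ p := by simp only [fermiOccupation, hG]
    simp [lindhardIntegrand, hocc]
  simp [lindhardFunction, h]

/-- Hence `chi0TP tp μ 0 = 0` for every `t′` and `μ`. -/
theorem chi0TP_zero (tp μ : ℝ) : chi0TP tp μ 0 = 0 := lindhardFunction_zero_transfer _ _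

/-- INPUT (C) as typed is the statement that `|χ₀| ≤ η_C` on the whole Cooper disc. -/
theorem cooperDiscModulusTP_iff_abs_le (tp μ r ηC : ℝ) :
    CooperDiscModulusTP tp μ r ηC ↔ ∀ q : Momentum, ‖q‖ ≤ r → |chi0TP tp μ q| ≤ ηC := by
  simp [CooperDiscModulusTP, chi0TP_zero]

/-- Consequently (C) is refuted by any point `q₀` of the disc at which `χ₀(q₀) > η_C` (e.g. any certified kernel box of the Cooper
band: there `χ₀ ≈ ρ(μ) ≈ 0.24 ≫ 10⁻⁴`). -/
theorem not_cooperDiscModulusTP_of_lt {tp μ r ηC : ℝ} {q₀ : Momentum} (hq : ‖q₀‖ ≤ r) (h : ηC < chi0TP tp μ q₀) :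
    ¬ CooperDiscModulusTP tp μ r ηC := by
  intro hC
  have := (cooperDiscModulusTP_iff_abs_le tp μ r ηC).1 hC q₀ hq
  have h' : chi0TP tp μ q₀ ≤ ηC := (le_abs_self _).trans this
  linarith

/-- In particular (C) with `η_C < 0` is absurd outright (take `q₀ = 0`). -/
theorem not_cooperDiscModulusTP_of_neg {tp μ r ηC : ℝ} (hr : 0 ≤ r) (hη : ηC < 0) : ¬ CooperDiscModulusTP tp μ r ηC := by
  intro hC
  have := (cooperDiscModulusTP_iff_abs_le tp μ r ηC).1 hC 0 (by simpa using hr)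
  linarith [abs_nonneg (chi0TP tp μ 0)]

/-- **REPAIRED INPUT (C′): the punctured Cooper-disc modulus about an explicit centre.**  For `0 < ‖q‖ ≤ r`,
`|χ₀(q) − c₀| ≤ η_C`, with `c₀` a rational of the record (the engine's value for `χ₀(0⁺) = ρ(μ)`; float at the (⅛, −0.3) cell
`ρ ≈ 0.242`, `η_C ≈ 10⁻⁴` for `r = 0.07`).  This is what the engine's Cooper-band enclosure actually certifies and what an
HS-integral consumer needs (the centre `q = 0` is a null set of the band). -/
def CooperDiscModulusPuncTP (tp μ r c₀ ηC : ℝ) : Prop :=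
  ∀ q : Momentum, 0 < ‖q‖ → ‖q‖ ≤ r → |chi0TP tp μ q - c₀| ≤ ηC

/-- Monotonicity of (C′) in its tolerance. -/
theorem cooperDiscModulusPuncTP_mono {tp μ r c₀ η η' : ℝ} (h : CooperDiscModulusPuncTP tp μ r c₀ η) (hη : η ≤ η') :
    CooperDiscModulusPuncTP tp μ r c₀ η' := fun q hq hq' => (h q hq hq').trans hη

/-- Shrinking the disc preserves (C′). -/
theorem cooperDiscModulusPuncTP_antitone_radius {tp μ r r' c₀ η : ℝ} (h : CooperDiscModulusPuncTP tp μ r c₀ η) (hr : r' ≤ r) :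
    CooperDiscModulusPuncTP tp μ r' c₀ η := fun q hq hq' => h q hq (hq'.trans hr)

/-- (C′) yields the two-sided pointwise enclosure `χ₀(q) ∈ [c₀ − η, c₀ + η]` on the punctured disc — the form a box-table consumer reads. -/
theorem cooperDiscModulusPuncTP.mem_Icc {tp μ r c₀ η : ℝ} (h : CooperDiscModulusPuncTP tp μ r c₀ η) {q : Momentum}
    (hq : 0 < ‖q‖) (hq' : ‖q‖ ≤ r) : chi0TP tp μ q ∈ Set.Icc (c₀ - η) (c₀ + η) := by
  have := abs_le.1 (h q hq hq')
  constructor <;> linarith [this.1, this.2]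

/-- Bridge: the old (C) is exactly (C′) with centre `c₀ = 0` plus nothing at the centre point (where it holds trivially), so a
consumer of (C) ports to (C′) by one rewrite — and (C) itself is only ever satisfiable with `η_C ≥ sup_{0<‖q‖≤r} χ₀(q)`. -/
theorem cooperDiscModulusTP_iff_punc_zero_centre (tp μ r ηC : ℝ) :
    CooperDiscModulusTP tp μ r ηC ↔ (0 ≤ r → 0 ≤ ηC) ∧ CooperDiscModulusPuncTP tp μ r 0 ηC := by
  rw [cooperDiscModulusTP_iff_abs_le]
  constructor
  · intro h
    refine ⟨fun hr => ?_, fun q _ hq' => by simpa using h q hq'⟩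
    have := h 0 (by simpa using hr)
    exact (abs_nonneg _).trans this
  · rintro ⟨h0, h⟩ q hq'
    by_cases hq : q = 0
    · subst hq
      simp [chi0TP_zero]
      exact h0 (by simpa using hq')
    · have hpos : 0 < ‖q‖ := norm_pos_iff.2 hq
      simpa using h q hpos hq'

end Summit.HubbardSuperconductivity.HubbardSuperconductivity.Theorems.KlCausticWindow

end
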